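import Literature.Analysis.FluidPDE.NSVorticity
import Literature.Analysis.FluidPDE.LerayHopfProofs
import Literature.Analysis.FunctionSpaces.LorentzOne
import HarnessLib

/-!
# Wang–Wu–Zhang 2023: the scaling-invariant Serrin criterion on ONE velocity component in the
# time-Lorentz class `u₃ ∈ L^{q,1}(0,T; L^p(ℝ³))`, `2/q + 3/p ≤ 1` (Theorem 1.1) — named fact

Topic `Analysis/FluidPDE`: one DEFINITION (the mixed time-Lorentz / space-Lebesgue class
`L^{q,1}(S; L^p)`, twin of `MemLqLp`) and one NAMED FACT (`def … : Prop`, D-0014) with a proved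
special case. Typed (statements first, D-0064) for the N0 one-velocity-component door of cell
`ns-regularity-ideate`, `Summit.NavierStokesRegularity.NavierStokesRegularity.Theses.LocalVelCompTubeDoor`
(source `doi:10.4171/aihpc/77`; its thesis: "one-velocity-component REGULARITY CRITERIA are
integrability conditions … Wang–Wu–Zhang doi:10.4171/aihpc/77, whose Rem. (3) leaves
same-position blow-up open", comparator "`v₃ ∈ L^{p,1}_t L^q_x`"), and named by
`….Theses.OneComponentPincer` / `….Theses.TypeIIInviscidRelaxation` (`WangWuZhang2023`). It is
the strongest printed one-component criterion at the scaling-critical line; the plain Lebesgue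
endpoint `u₃ ∈ L^q_t L^p_x`, `2/q + 3/p = 1` is OPEN (Remark (2)), the strict case
`2/q + 3/p < 1` is Chae–Wolf 2021 (`chaeWolf2021_oneComponent_almostSerrin_criterion`).

## Source

W. Wang, D. Wu, Z. Zhang, *Scaling-invariant Serrin criterion via one velocity component for the
Navier–Stokes equations*, Ann. Inst. H. Poincaré Anal. Non Linéaire (2023, online first),
doi:10.4171/aihpc/77 = arXiv:2005.11906 [WangWuZhang2023] (held: lit key
`paper:doi-10-4171-aihpc-77`). §1: (NS) `∂ₜu − Δu + u·∇u + ∇π = 0`, `div u = 0`, `u(x,0) = u₀`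
(viscosity `1`). Abstract: "we prove that the Leray weak solution is also regular in
`ℝ³ × (0,T)` under the scaling-invariant Serrin condition imposed on one component of the
velocity, i.e., `u₃ ∈ L^{q,1}(0,T; L^p(ℝ³))` with `2/q + 3/p ≤ 1`, `3 < p < +∞`. This result means
that if the solution blows up at a time, then all three components of the velocity have to blow
up simultaneously."

**Theorem 1.1** (p. 3, verbatim). "Let `u₀ ∈ L²(ℝ³) ∩ L³(ℝ³)` and `(u, π)` be a Leray weak
solution of (NS) in `ℝ³ × (0,T)`. If `u` satisfies the condition
`u₃ ∈ L^{q,1}(0,T; L^p(ℝ³))` (1.2) for some `(p,q)` with `2/q + 3/p ≤ 1`, `3 < p < ∞`, then `u`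
is regular in `ℝ³ × (0,T)`. Here `L^{q,1}` denotes the Lorentz space with respect to the variable
`t`." Remarks (p. 4): "(2) … Due to the inclusion `L^{q,1} ⊊ L^q` for `q > 1`, the regularity of
the weak solution under the condition `u₃ ∈ L^q(0,T; L^p(ℝ³))` with `2/q + 3/p = 1` is still
open. (3) Our result means that if the solution blows up at time `T`, then three components of
the velocity will blow up at the same time. However, it remains open whether three components
(or two components) of the velocity blow up at the same time and same position."
Proof of Thm 1.1 (§4, pp. 21–22): "Due to `u₀ ∈ L³(ℝ³)` … `(u, π)` is regular in `ℝ³ × (0,T₀)`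
… Assume that `T₀` is the first blow-up time. However, we will prove that the point `(x, T₀)`
for any `x ∈ ℝ³` is a regular point" (via Theorem 1.2 on `ℝ³ × (−1,0)` and the interior
criterion [36, Thm 1.4]); the Lorentz space is used through its atomic decomposition
(Appendix, (A.1); norm via the decreasing rearrangement, `‖f‖^q_{L^{p,q}} = ∫₀^∞ (s^{1/p}f*(s))^q ds/s`).

## Rendering (the tree's continuation frame, ns.S27 — verbatim that of
`chaeWolf2021_oneComponent_almostSerrin_criterion`, `baeChoe_two_velocity_components_criterion`)

* `(u, p)` a classical unforced solution on `ℝ³ × [0,T)` (`IsClassicalNSSolutionOn (Ico 0 T) ν 0 u p`)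
  in the Beale–Kato–Majda class on every `[0,T'']`, `T'' < T` — a Leray weak solution on
  `ℝ³ × (0,T)` from the datum `u 0 ∈ ⋂ₙHⁿ ⊂ L² ∩ L³`, so the printed hypotheses hold.
* `u₃ ∈ L^{q,1}(0,T; L^p(ℝ³))`: `MemLorentzOneLqLp a b (u·e₃) (Ioo 0 T)` (definition below: the
  time-distribution-function form `∫₀^∞ |{t ∈ S : ‖u₃(t)‖_{L^b} > λ}|^{1/a} dλ < ∞`, which is
  membership in `L^{a,1}(S; L^b)` by Grafakos, *Classical Fourier Analysis*, Prop. 1.4.9: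
  `‖g‖_{L^{a,1}} = a∫₀^∞ d_g(λ)^{1/a} dλ`), with `2/a + 3/b ≤ 1`, `3 < b < ∞`. (`a = ∞`: the
  exponent `1/∞.toReal = 0` makes the integrand `1` and the class EMPTY, so that case of the
  `def` is vacuous; in print the time class `L^{∞,1}` is `{0}` (Grafakos, before Prop. 1.4.9) and
  Kang–Nguyen 2022 (arXiv:2206.02490, §1) report the range as `2 < q < ∞`, `3 < p < ∞`.) `u₃` is
  the Cartesian component of index `2 : Fin 3` (the paper's frame; no rotation is performed).
* Conclusion: continuation in the class past `T` (`HasSobolevExtensionPast ν u T`). The printed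
  conclusion is "regular in `ℝ³ × (0,T)`"; what is rendered is the theorem's content as the
  authors state it ("if the solution blows up at a time, then all three components of the
  velocity have to blow up simultaneously", abstract and Remark (3)) and as the proof delivers it
  (no first blow-up time `T₀ ≤ T` under (1.2) on `(0,T)`: every `(x, T₀)` is a regular point) —
  for the rendered class: the solution does not blow up at `T`, i.e. continues. Declared
  rendering step: "every point of the top slice regular ⇒ continuation" for finite-energy
  classical solutions (the same step as in Chae–Wolf 2021, §2: "`(x₀,T_*)` is a regular point. In
  particular, `u ∈ L^∞(0,T_*; L³)`").
* Viscosity: printed for `ν = 1`; stated for every `ν > 0` (scaling `v(s,y) = ν⁻¹u(s/ν,y)`; the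
  Lorentz class is dilation-covariant), the convention of every criterion in this directory.

## What is NOT here

Theorem 1.2 (the local scaled-`L³` bound for suitable weak solutions on `ℝ³ × (−1,0)`), §§2–3,
the atomic decomposition; no embedding `L^{q,1} ⊂ L^q` is proved here (so no formal comparison
with `MemLqLp`). The generic scalar Lorentz functional lives in
`Literature/Analysis/FunctionSpaces/LorentzOne.lean` (`eLorentzOneNorm`, proposed alongside); the
mixed class below is written out directly, exactly as `MemLqLp` is written out from `eLpNorm`, so
that this file does not depend on it.

## References

* W. Wang, D. Wu, Z. Zhang, Ann. Inst. H. Poincaré C (2023), doi:10.4171/aihpc/77: abstract,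
  Thm. 1.1 (p. 3), Remarks (2)–(3) (p. 4), §4 (pp. 21–22), Appendix (A.1). [WangWuZhang2023]
* L. Grafakos, *Classical Fourier Analysis*, 3rd ed. (2014), Def. 1.4.6, Prop. 1.4.9. [Grafakos2014]
* D. Chae, J. Wolf, Arch. Ration. Mech. Anal. 240 (2021), Thm. 1.2 and §2. [ChaeWolf2021]
* J. Serrin, in *Nonlinear Problems* (1963), §3 (mixed classes). [Serrin1963]
-/

noncomputable section

open MeasureTheory Set Function Filter
open _root_.Topology
open scoped ENNReal NNReal

namespace Literature.Analysis.FluidPDE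

section Mixed

variable {X : Type*} [MeasureSpace X] {F : Type*} [NormedAddCommGroup F]

/-- **The mixed time-Lorentz class `u ∈ L^{q,1}(S; L^p(X))`** (Wang–Wu–Zhang 2023, (1.2):
"`L^{q,1}` denotes the Lorentz space with respect to the variable `t`"), in distribution-function
form: the slices `u t` lie in `L^p` for a.e. `t ∈ S`, and
`∫₀^∞ |{t ∈ S : λ < ‖u t‖_{L^p}}|^{1/q} dλ < ∞` — finiteness of `q⁻¹‖ t ↦ ‖u t‖_{L^p} ‖_{L^{q,1}(S)}`
in the normalisation of Grafakos, Prop. 1.4.9 (`‖g‖_{L^{q,1}} = q ∫₀^∞ d_g(λ)^{1/q} dλ`). Twin of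
`MemLqLp q p u S` (`L^q(S; L^p)`); the exponent enters through `q.toReal`, so for `q ∈ {0, ∞}` the
integrand is `1` and the class is EMPTY (junk, documented; `L^{∞,1} = {0}`-type degeneracy).
Strong measurability in time is not demanded (as for `MemLqLp`). [cite: WangWuZhang2023, (1.2) and Thm. 1.1 (p. 3); Grafakos2014, Prop. 1.4.9] -/
def MemLorentzOneLqLp (q p : ℝ≥0∞) (u : ℝ → X → F) (S : Set ℝ) : Prop :=
  (∀ᵐ t ∂(volume.restrict S), MemLp (u t) p volume) ∧
    ∫⁻ lam in Ioi (0 : ℝ),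
        (volume.restrict S) {t | ENNReal.ofReal lam < eLpNorm (u t) p volume} ^ (1 / q.toReal) < ∞

/-- Unfolding lemma for `MemLorentzOneLqLp` (Wang–Wu–Zhang's class (1.2) in the
distribution-function form of Grafakos, Prop. 1.4.9). [cite: WangWuZhang2023, (1.2) p. 3; Grafakos2014, Prop. 1.4.9] -/
theorem memLorentzOneLqLp_iff (q p : ℝ≥0∞) (u : ℝ → X → F) (S : Set ℝ) :
    MemLorentzOneLqLp q p u S ↔
      (∀ᵐ t ∂(volume.restrict S), MemLp (u t) p volume) ∧
        ∫⁻ lam in Ioi (0 : ℝ),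
            (volume.restrict S) {t | ENNReal.ofReal lam < eLpNorm (u t) p volume} ^ (1 / q.toReal)
          < ∞ :=
  Iff.rfl

/-- A field whose slices vanish a.e. in space for a.e. `t ∈ S` lies in `L^{q,1}(S; L^p)` for
`0 < q < ∞`: its slice norms vanish for a.e. `t ∈ S`, so every level set `{λ < ‖u t‖_p}`,
`λ > 0`, is null in `S` and the integrand is `0^{1/q} = 0` (the zero element of the quasi-normed
space `L^{q,1}`, Grafakos Def. 1.4.6, in the class (1.2) of Wang–Wu–Zhang). [cite: Grafakos2014, Def. 1.4.6 and Prop. 1.4.9; WangWuZhang2023, (1.2) p. 3] -/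
theorem memLorentzOneLqLp_of_ae_slice_eq_zero {q p : ℝ≥0∞} (hq0 : q ≠ 0) (hqtop : q ≠ ∞)
    {u : ℝ → X → F} {S : Set ℝ}
    (h : ∀ᵐ t ∂(volume.restrict S), u t =ᵐ[volume] 0) : MemLorentzOneLqLp q p u S := by
  have hq : 0 < 1 / q.toReal := by
    have := ENNReal.toReal_pos hq0 hqtop
    positivity
  refine ⟨?_, ?_⟩
  · filter_upwards [h] with t ht
    exact (MemLp.zero (p := p) (μ := volume) (ε := F)).ae_eq ht.symm
  · have hnull : ∀ lam : ℝ, 0 < lam →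
        (volume.restrict S) {t | ENNReal.ofReal lam < eLpNorm (u t) p volume} = 0 := by
      intro lam _hlam
      rw [measure_eq_zero_iff_ae_notMem]
      filter_upwards [h] with t ht
      simp only [not_lt]
      rw [eLpNorm_congr_ae ht, eLpNorm_zero]
      exact zero_le
    have hcongr : EqOn
        (fun lam : ℝ =>
          (volume.restrict S) {t | ENNReal.ofReal lam < eLpNorm (u t) p volume} ^ (1 / q.toReal))
        (fun _ => 0) (Ioi (0 : ℝ)) := by
      intro lam hlam
      show (volume.restrict S) {t | ENNReal.ofReal lam < eLpNorm (u t) p volume} ^ (1 / q.toReal)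
        = 0
      rw [hnull lam hlam, ENNReal.zero_rpow_of_pos hq]
    rw [setLIntegral_congr_fun measurableSet_Ioi hcongr, lintegral_zero]
    exact ENNReal.zero_lt_top

end Mixed

/-- **Wang–Wu–Zhang 2023, Theorem 1.1** (Ann. Inst. H. Poincaré C, doi:10.4171/aihpc/77, p. 3:
"Let `u₀ ∈ L²(ℝ³) ∩ L³(ℝ³)` and `(u, π)` be a Leray weak solution of (NS) in `ℝ³ × (0,T)`. If `u`
satisfies the condition `u₃ ∈ L^{q,1}(0,T; L^p(ℝ³))` for some `(p,q)` with `2/q + 3/p ≤ 1`,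
`3 < p < ∞`, then `u` is regular in `ℝ³ × (0,T)`"; abstract / Remark (3): "if the solution blows
up at a time, then all three components of the velocity have to blow up simultaneously"; proof
§4: no first blow-up time `T₀`, every `(x,T₀)` being a regular point), in the tree's continuation
frame (module docstring; that of `chaeWolf2021_oneComponent_almostSerrin_criterion`): for `ν > 0`,
`T > 0` and a classical unforced solution `(u, p)` on `ℝ³ × [0,T)` in the Beale–Kato–Majda class
on every `[0,T'']`, `T'' < T`, if the third velocity component `u₃ = u · e₃` lies in the
time-Lorentz class `L^{a,1}(0,T; L^b(ℝ³))` (`MemLorentzOneLqLp a b`) with `2/a + 3/b ≤ 1` and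
`3 < b < ∞`, then `u` continues in the class past `T`. Statement only (the printed proof: a new
iteration scheme, local anisotropic energy estimates, atomic decomposition of `L^{q,1}`); users
take `(h : wangWuZhang2023_oneComponent_lorentzSerrin_criterion)`. [cite: WangWuZhang2023, Thm. 1.1 with (1.2) (p. 3), Remarks (2)–(3) (p. 4), §4 (pp. 21–22)] -/
def wangWuZhang2023_oneComponent_lorentzSerrin_criterion : Prop :=
  ∀ ⦃ν : ℝ⦄, 0 < ν → ∀ ⦃T : ℝ⦄, 0 < T →
    ∀ ⦃u : ℝ → EuclideanSpace ℝ (Fin 3) → EuclideanSpace ℝ (Fin 3)⦄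
      ⦃p : ℝ → EuclideanSpace ℝ (Fin 3) → ℝ⦄,
      IsClassicalNSSolutionOn (Ico 0 T) ν 0 u p →
      (∀ T'' < T, HasBoundedSobolevNormsOn (Icc 0 T'') u) →
      ∀ ⦃a b : ℝ≥0∞⦄,
        -- `u₃ ∈ L^{a,1}(0,T; L^b(ℝ³))` (Lorentz in time), `2/a + 3/b ≤ 1`, `3 < b < ∞`
        2 / a + 3 / b ≤ 1 → 3 < b → b < ⊤ →
        MemLorentzOneLqLp a b (fun t x => u t x 2) (Ioo 0 T) →
      HasSobolevExtensionPast ν u T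

/-- An admissible exponent pair on the critical line of Wang–Wu–Zhang's condition (1.2):
`(a, b) = (4, 6)` satisfies `2/a + 3/b ≤ 1` (indeed `= 1`) with `3 < 6 < ∞` — the pair
`u₃ ∈ L^{4,1}(0,T; L⁶(ℝ³))`. [cite: WangWuZhang2023, (1.2) p. 3] -/
theorem wangWuZhang2023_exponents_four_six :
    (2 : ℝ≥0∞) / 4 + 3 / 6 ≤ 1 ∧ (3 : ℝ≥0∞) < 6 ∧ (6 : ℝ≥0∞) < ⊤ := by
  refine ⟨le_of_eq ?_, by norm_num, ENNReal.ofNat_lt_top⟩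
  have h1 : (2 : ℝ≥0∞) / 4 = 1 / 2 := by
    rw [ENNReal.div_eq_div_iff (by norm_num) (by norm_num) (by norm_num) (by norm_num)]
    norm_num
  have h2 : (3 : ℝ≥0∞) / 6 = 1 / 2 := by
    rw [ENNReal.div_eq_div_iff (by norm_num) (by norm_num) (by norm_num) (by norm_num)]
    norm_num
  rw [h1, h2, ENNReal.div_add_div_same, one_add_one_eq_two,
    ENNReal.div_self two_ne_zero ENNReal.ofNat_ne_top]

/-- **Special case of Wang–Wu–Zhang 2023, Theorem 1.1**: a classical solution of the frame whose
third velocity component vanishes for a.e. `t ∈ (0,T)` and a.e. `x` continues past `T` — the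
instance `(a,b) = (4,6)` of the fact, the zero slices lying in `L^{4,1}(0,T; L⁶)`
(`memLorentzOneLqLp_of_ae_slice_eq_zero`); conditional on the fact (the form in which the
one-velocity-component door K2′ of cell `ns-regularity-ideate`, "`v · e ≡ 0`", meets the printed
criterion). [cite: WangWuZhang2023, Thm. 1.1 (p. 3)] -/
theorem wangWuZhang2023_oneComponent_lorentzSerrin_criterion.of_ae_eq_zero
    (h : wangWuZhang2023_oneComponent_lorentzSerrin_criterion) {ν : ℝ} (hν : 0 < ν) {T : ℝ}
    (hT : 0 < T) {u : ℝ → EuclideanSpace ℝ (Fin 3) → EuclideanSpace ℝ (Fin 3)}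
    {p : ℝ → EuclideanSpace ℝ (Fin 3) → ℝ}
    (hsol : IsClassicalNSSolutionOn (Ico 0 T) ν 0 u p)
    (hreg : ∀ T'' < T, HasBoundedSobolevNormsOn (Icc 0 T'') u)
    (hu : ∀ᵐ t ∂(volume.restrict (Ioo 0 T)), (fun x => u t x 2) =ᵐ[volume] 0) :
    HasSobolevExtensionPast ν u T := by
  obtain ⟨hab, hb, hbtop⟩ := wangWuZhang2023_exponents_four_six
  exact h hν hT hsol hreg hab hb hbtop
    (memLorentzOneLqLp_of_ae_slice_eq_zero (by norm_num) ENNReal.ofNat_ne_top hu)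


/-! ### `L^{q,1}(S; L^p) ⊂ L^q(S; L^p)`: the time-Lorentz class refines the mixed Lebesgue class -/

section Embedding

variable {X : Type*} [MeasureSpace X] {F : Type*} [NormedAddCommGroup F]

/-- **The time-Lorentz class lies inside the Prodi–Serrin mixed class**: for `1 ≤ q < ∞`,
`u ∈ L^{q,1}(S; L^p)` (`MemLorentzOneLqLp q p u S`) implies `u ∈ L^q(S; L^p)` (`MemLqLp q p u S`),
provided the slice-norm function `t ↦ ‖u t‖_{L^p}` is a.e.-strongly measurable on `S` (neither
mixed class records time measurability; the layer-cake argument needs it). This is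
`L^{q,1} ⊊ L^q` in the time variable (Wang–Wu–Zhang 2023, Remark (2); Grafakos, Prop. 1.4.10 with
`r = q`), through `Literature.Analysis.FunctionSpaces.MemLorentzOne.memLp` applied to the
slice-norm function, whose extended superlevel sets `{ofReal λ < ‖(‖u t‖_p).toReal‖ₑ}` sit inside
`{ofReal λ < ‖u t‖_p}`. So Wang–Wu–Zhang's hypothesis (1.2) is (for measurable slice norms) a
sub-case of the Prodi–Serrin-line hypothesis `u₃ ∈ L^q_t L^p_x`, `2/q + 3/p ≤ 1`, whose plain
endpoint is open in print. [cite: WangWuZhang2023, Remark (2) p. 4; Grafakos2014, Prop. 1.4.10] -/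
theorem MemLorentzOneLqLp.memLqLp {q p : ℝ≥0∞} {u : ℝ → X → F} {S : Set ℝ}
    (h : MemLorentzOneLqLp q p u S) (hq1 : 1 ≤ q) (hqtop : q ≠ ∞)
    (hmeas : AEStronglyMeasurable (fun t => (eLpNorm (u t) p volume).toReal) (volume.restrict S)) :
    MemLqLp q p u S := by
  refine ⟨h.1, ?_⟩
  have hg : FunctionSpaces.MemLorentzOne (fun t => (eLpNorm (u t) p volume).toReal) q
      (volume.restrict S) := by
    refine ⟨hmeas, lt_of_le_of_lt ?_ h.2⟩
    unfold FunctionSpaces.eLorentzOneNorm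
    refine lintegral_mono fun lam => ?_
    refine ENNReal.rpow_le_rpow (measure_mono fun t ht => ?_) (by positivity)
    have ht' : ENNReal.ofReal lam < ‖(eLpNorm (u t) p volume).toReal‖ₑ := ht
    rw [Real.enorm_eq_ofReal ENNReal.toReal_nonneg] at ht'
    exact lt_of_lt_of_le ht' ENNReal.ofReal_toReal_le
  exact (FunctionSpaces.MemLorentzOne.memLp hg hq1 hqtop).2

end Embedding

end Literature.Analysis.FluidPDE

end
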